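import Literature.NumberTheory.Automorphic.BorelBruhatCellsGK
import HarnessLib

/-!
# Gelfand–Kazhdan's combinatorial lemma: `ψ_U`-relevant monomial matrices are fixed by the
involution `ι(g) = w⁰ ᵗg w⁰`

Topic `NumberTheory/Automorphic`. The `(U_n × U_n)`-orbits on `GL_n(F)` (action
`(u₁, u₂) · g = u₁ g u₂⁻¹`) are represented by the monomial matrices `m = d P_σ` (`d` diagonal,
`P_σ` a permutation matrix; `BorelBruhatCellsGK`). The stabiliser of `m` is
`{(m u m⁻¹, u) : u ∈ U_n ∩ m⁻¹ U_n m}`, so the orbit of `m` carries a non-zero distribution that is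
`(ψ_U, ψ_U⁻¹)`-quasi-invariant only if `ψ_U(m u m⁻¹) = ψ_U(u)` for all `u ∈ U_n` with
`m u m⁻¹ ∈ U_n` (*`m` is `ψ`-relevant*). The key combinatorial input of Gelfand–Kazhdan's proof of
the `ι`-invariance of bi-`ψ_U`-quasi-invariant distributions (Gelfand–Kazhdan 1975, §4;
Bernstein–Zelevinsky 1976, §7; for `n = 2` Bump 1997, pp. 456–457, where the relevant double cosets
are `B` with `a = d` and the big cell) is:

* `gkInvolution_eq_self_of_relevant` — **a `ψ`-relevant monomial matrix is fixed by `ι`**: if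
  `ψ ≠ 1` and `ψ_U(m u m⁻¹) = ψ_U(u)` for all `u ∈ U_n` with `m u m⁻¹ ∈ U_n`, `m = diag(d) P_σ`, then
  `ι(m) = m`.

Proof. Testing the hypothesis on the root elements `u = 1 + x E_{i,i+1}` (the tree's `transvectionGL`),
whose conjugate `m u m⁻¹ = 1 + (d_a x d_b⁻¹) E_{a b}` (`a = σ⁻¹ i`, `b = σ⁻¹ (i+1)`,
`conj_transvectionGL`) lies in `U_n` iff `a < b`, and using `ψ_U(1 + y E_{ab}) = ψ(y [b = a + 1])`
(`whittakerCharFun_transvectionGL_of_lt`) and the non-triviality of `ψ`, one finds: for every `i`, either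
`σ⁻¹(i+1) < σ⁻¹ i`, or `σ⁻¹(i+1) = σ⁻¹ i + 1` and `d_{σ⁻¹ i} = d_{σ⁻¹ (i+1)}`
(`descent_or_of_relevant`). The purely combinatorial lemma `perm_involutive_of_descents_by_one`
(a permutation `κ` of `Fin n` all of whose descents are by exactly one, together with a colouring
`c` constant along the descents, satisfies `κ² = 1` and `c ∘ κ = c`: the maximal descending runs
are intervals mapped onto themselves, proved by peeling off the run through the largest value and
induction on `n`), applied to `κ = rev ∘ σ⁻¹` and `c = d ∘ rev`, gives `σ rev σ = rev` and
`d_{rev (σ i)} = d_i`, which is exactly `ι(d P_σ) = d P_σ` entrywise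
(`gkInvolution_diagonalGL_mul_permGL_eq_iff`).

Everything is proved; there is no new definition (the root elements are the tree's `transvectionGL`). No named fact is introduced.

## References

* I. M. Gelfand, D. A. Kazhdan, *Representations of the group GL(n, K) where K is a local field*,
  in: Lie groups and their representations (Budapest 1971), Halsted (1975), 95–118, §4.
  [GelfandKazhdan1975]
* I. N. Bernstein, A. V. Zelevinsky, *Representations of the group GL(n, F) where F is a
  non-archimedean local field*, Russian Math. Surveys 31:3 (1976), 1–68, §7.
  [BernsteinZelevinskyRMS1976]
* D. Bump, *Automorphic Forms and Representations* (1997), §4.4, proof of Theorem 4.4.2 for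
  `GL(2)`, pp. 456–457. [Bump1997]
-/

open Matrix

namespace Literature.NumberTheory.Automorphic

/-! ### The combinatorial lemma: permutations whose descents are all by one -/

section Combinatorics

variable {X : Type*}

/-- **Permutations all of whose descents are by exactly one are involutions.** Let `κ` be a
permutation of `Fin n` and `c` a colouring of `Fin n` such that for all consecutive `i, i + 1`:
either `κ i < κ (i+1)`, or `κ (i+1) = κ i - 1` and `c (κ (i+1)) = c (κ i)`. Then `κ (κ i) = i` and
`c (κ i) = c i` for all `i` (the maximal descending runs of `κ` are intervals reversed onto
themselves, and `c` is constant on each). Proof: the run starting at the position `p` of the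
largest value `n - 1` must descend by one down to the last position, so it occupies the positions
`≥ p` and the values `≥ p`, on which `κ i = n - 1 + p - i`; the restriction of `κ` to `Fin p`
satisfies the same hypothesis, and we induct on `n`. [folklore] -/
theorem perm_involutive_of_descents_by_one :
    ∀ {n : ℕ} (κ : Equiv.Perm (Fin n)) (c : Fin n → X),
      (∀ i j : Fin n, (j : ℕ) = i + 1 →
        κ i < κ j ∨ (((κ j : Fin n) : ℕ) + 1 = κ i ∧ c (κ j) = c (κ i))) →
      ∀ i : Fin n, κ (κ i) = i ∧ c (κ i) = c i := by
  intro n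
  induction n using Nat.strong_induction_on with
  | _ n ih =>
  intro κ c h
  rcases Nat.eq_zero_or_pos n with hn | hn
  · subst hn; intro i; exact i.elim0
  set last : Fin n := ⟨n - 1, by omega⟩ with hlast
  set p : Fin n := κ.symm last with hp
  -- Step 1: the run through the largest value: `κ (p + t) = n - 1 - t`, `c (κ (p + t)) = c last`
  have hrun : ∀ t : ℕ, ∀ i : Fin n, (i : ℕ) = p + t → ((κ i : Fin n) : ℕ) + t = n - 1 ∧ c (κ i) = c last := by
    intro t
    induction t using Nat.strong_induction_on with
    | _ t iht =>
    intro i hi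
    rcases Nat.eq_zero_or_pos t with ht | ht
    · subst ht
      have : i = p := Fin.ext (by rw [hi, add_zero])
      rw [this, hp, Equiv.apply_symm_apply]
      exact ⟨rfl, rfl⟩
    · -- `i = i₀ + 1` with `i₀ = p + (t - 1)`
      set i₀ : Fin n := ⟨p + (t - 1), by omega⟩ with hi₀
      have hi₀t := iht (t - 1) (by omega) i₀ rfl
      rcases h i₀ i (by rw [hi, hi₀]; simp; omega) with hlt | ⟨heq, hc⟩
      · -- `κ i > κ i₀ = n - t`: then `κ i = n - 1 - s` with `s < t - 1 ...` contradiction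
        exfalso
        have hki : ((κ i : Fin n) : ℕ) < n := (κ i).isLt
        set s := n - 1 - ((κ i : Fin n) : ℕ) with hs
        have hslt : s < t - 1 := by
          have := Fin.lt_def.1 hlt
          omega
        set i₁ : Fin n := ⟨p + s, by omega⟩ with hi₁
        have h₁ := (iht s (by omega) i₁ rfl).1
        have : κ i₁ = κ i := Fin.ext (by rw [hi₁] at h₁ ⊢; omega)
        have := congrArg (fun x : Fin n => (x : ℕ)) (κ.injective this)
        simp [hi₁, hi] at this
        omega
      · refine ⟨by omega, ?_⟩
        rw [hc]
        exact hi₀t.2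
  -- consequences on the positions `≥ p`
  have hge : ∀ i : Fin n, (p : ℕ) ≤ i → ((κ i : Fin n) : ℕ) + i = n - 1 + p ∧ c (κ i) = c last := by
    intro i hpi
    have := hrun (i - p) i (by omega)
    exact ⟨by omega, this.2⟩
  have hinv : ∀ i : Fin n, (p : ℕ) ≤ i → κ (κ i) = i ∧ c (κ i) = c i := by
    intro i hpi
    have h1 := hge i hpi
    have hκi : (p : ℕ) ≤ (κ i : Fin n) := by have := i.isLt; omega
    have h2 := hge (κ i) hκi
    have hκκ : κ (κ i) = i := Fin.ext (by omega)
    refine ⟨hκκ, ?_⟩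
    rw [h1.2, ← h2.2, hκκ]
  -- Step 2: restriction to `Fin p`
  have hpn : (p : ℕ) < n := p.isLt
  have hlt_of_lt : ∀ i : Fin n, (i : ℕ) < p → ((κ i : Fin n) : ℕ) < p := by
    intro i hi
    by_contra hge'
    push Not at hge'
    have h1 := (hinv (κ i) hge').1
    have h2 : κ i = κ (κ (κ i)) := by rw [h1]
    have h3 := κ.injective h2
    have h4 := (hge (κ i) hge').1
    have : (i : ℕ) = ((κ (κ i) : Fin n) : ℕ) := congrArg (fun x : Fin n => (x : ℕ)) h3
    omega
  set e : Fin p → Fin n := Fin.castLE hpn.le with he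
  set κ' : Fin p → Fin p := fun i => ⟨κ (e i), hlt_of_lt (e i) (by rw [he]; exact i.isLt)⟩ with hκ'
  have hκ'inj : Function.Injective κ' := fun i j hij => by
    have : κ (e i) = κ (e j) := Fin.ext (congrArg (fun x : Fin p => (x : ℕ)) hij)
    exact Fin.castLE_injective _ (κ.injective this)
  set σ' : Equiv.Perm (Fin p) := Equiv.ofBijective κ' hκ'inj.bijective_of_finite with hσ'
  have hσ'e : ∀ i : Fin p, e (σ' i) = κ (e i) := fun i => rfl
  set c' : Fin p → X := c ∘ e with hc'
  have h' : ∀ i j : Fin p, (j : ℕ) = i + 1 →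
      σ' i < σ' j ∨ (((σ' j : Fin p) : ℕ) + 1 = σ' i ∧ c' (σ' j) = c' (σ' i)) := by
    intro i j hij
    rcases h (e i) (e j) (by simpa [he] using hij) with hlt | ⟨heq, hceq⟩
    · exact Or.inl hlt
    · refine Or.inr ⟨heq, ?_⟩
      simp only [hc', Function.comp_apply, hσ'e]
      exact hceq
  have ih' := ih p hpn σ' c' h'
  -- conclusion
  intro i
  by_cases hpi : (p : ℕ) ≤ i
  · exact hinv i hpi
  · push Not at hpi
    set i₀ : Fin p := ⟨i, hpi⟩ with hi₀
    have hei : e i₀ = i := rfl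
    obtain ⟨h1, h2⟩ := ih' i₀
    have hκi : κ i = e (σ' i₀) := by rw [hσ'e, hei]
    constructor
    · rw [hκi, ← hσ'e, h1, hei]
    · have : c (κ i) = c' (σ' i₀) := by rw [hκi]; rfl
      rw [this, h2, hc', Function.comp_apply, hei]

end Combinatorics

/-! ### Root elements `1 + x E_{ij}` of `U_n` (`transvectionGL`): generic character and conjugates -/

section Matrices

variable {F : Type*} [Field F] {n : ℕ}

/-- **The super-diagonal sum of a root element** `1 + x E_{ij}`, `i < j` (adjacent or not):
`∑_k (1 + x E_{ij})_{k,k+1} = x [j = i + 1]` (the tree's `superdiagSum_transvectionGL` is the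
adjacent case). [folklore] -/
theorem superdiagSum_transvectionGL_of_lt {i j : Fin n} (hij : i < j) (x : F) :
    superdiagSum ⟨transvectionGL i j hij.ne x, transvectionGL_mem_upperUnitriangular hij x⟩ =
      if (i : ℕ) + 1 = j then x else 0 := by
  rw [superdiagSum_def]
  simp only [transvectionGL_apply]
  have hterm : ∀ k l : Fin n, (if (k : ℕ) + 1 = l then
      ((if k = l then (1 : F) else 0) + if i = k ∧ j = l then x else 0) else 0) =
      if i = k ∧ j = l then (if (i : ℕ) + 1 = j then x else 0) else 0 := by
    intro k l
    by_cases hkl : (k : ℕ) + 1 = l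
    · rw [if_pos hkl, if_neg (fun h : k = l => by rw [h] at hkl; omega), zero_add]
      by_cases h : i = k ∧ j = l
      · obtain ⟨rfl, rfl⟩ := h
        rw [if_pos ⟨rfl, rfl⟩, if_pos hkl, if_pos ⟨rfl, rfl⟩]
      · rw [if_neg h, if_neg h]
    · rw [if_neg hkl]
      by_cases h : i = k ∧ j = l
      · obtain ⟨rfl, rfl⟩ := h
        rw [if_pos ⟨rfl, rfl⟩, if_neg hkl]
      · rw [if_neg h]
  simp only [hterm]
  rw [Finset.sum_eq_single i, Finset.sum_eq_single j]
  · rw [if_pos ⟨rfl, rfl⟩]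
  · intro l _ hl; rw [if_neg (fun h => hl h.2.symm)]
  · exact fun h => absurd (Finset.mem_univ _) h
  · intro k _ hk
    exact Finset.sum_eq_zero fun l _ => if_neg fun h => hk h.1.symm
  · exact fun h => absurd (Finset.mem_univ _) h

/-- **The generic character on a root element**: `ψ_U(1 + x E_{ij}) = ψ(x)` if `j = i + 1` and
`= 1` otherwise (`i < j`). [folklore] -/
theorem whittakerCharFun_transvectionGL_of_lt (ψ : AddChar F Circle) {i j : Fin n} (hij : i < j) (x : F) :
    whittakerCharFun ψ ⟨transvectionGL i j hij.ne x, transvectionGL_mem_upperUnitriangular hij x⟩ =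
      if (i : ℕ) + 1 = j then ((ψ x : Circle) : ℂ) else 1 := by
  rw [whittakerCharFun_apply, superdiagSum_transvectionGL_of_lt hij]
  split_ifs
  · rfl
  · rw [AddChar.map_zero_eq_one, Circle.coe_one]

/-- **Conjugating a root element by a monomial matrix**:
`(d P_σ) (1 + x E_{ij}) (d P_σ)⁻¹ = 1 + (d_a x d_b⁻¹) E_{ab}` with `a = σ⁻¹ i`, `b = σ⁻¹ j`.
[folklore] -/
theorem conj_transvectionGL (d : Fin n → Fˣ) (σ : Equiv.Perm (Fin n)) {i j : Fin n} (hij : i ≠ j) (x : F) :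
    (diagonalGL (Fin n) F d * permGL σ) * transvectionGL i j hij x * (diagonalGL (Fin n) F d * permGL σ)⁻¹ =
      transvectionGL (σ.symm i) (σ.symm j) (fun h => hij (σ.symm.injective h))
        ((d (σ.symm i) : F) * x * ((d (σ.symm j))⁻¹ : Fˣ)) := by
  set u : GL (Fin n) F := permGL σ * transvectionGL i j hij x * (permGL σ)⁻¹ with hu
  have hconj : (diagonalGL (Fin n) F d * permGL σ) * transvectionGL i j hij x *
      (diagonalGL (Fin n) F d * permGL σ)⁻¹ = diagonalGL (Fin n) F d * u * (diagonalGL (Fin n) F d)⁻¹ := by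
    rw [hu]; group
  have hu_apply : ∀ k l, (u : Matrix (Fin n) (Fin n) F) k l =
      (if k = l then 1 else 0) + (if σ.symm i = k ∧ σ.symm j = l then x else 0) := by
    intro k l
    rw [hu, permGL_inv, Units.val_mul, Units.val_mul, permGL_mul_mul_permGL_apply, transvectionGL_apply,
      Equiv.Perm.inv_def, Equiv.symm_symm]
    congr 1
    · by_cases h : k = l
      · rw [if_pos (by rw [h]), if_pos h]
      · rw [if_neg (fun h' => h (σ.injective h')), if_neg h]
    · by_cases h : σ.symm i = k ∧ σ.symm j = l
      · rw [if_pos h, if_pos]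
        obtain ⟨h1, h2⟩ := h
        exact ⟨by rw [← h1, Equiv.apply_symm_apply], by rw [← h2, Equiv.apply_symm_apply]⟩
      · rw [if_neg h, if_neg]
        rintro ⟨h1, h2⟩
        exact h ⟨by rw [h1, Equiv.symm_apply_apply], by rw [h2, Equiv.symm_apply_apply]⟩
  rw [hconj]
  apply Units.ext
  ext k l
  rw [diagonalGL_conj_apply, hu_apply, transvectionGL_apply]
  by_cases h : σ.symm i = k ∧ σ.symm j = l
  · obtain ⟨rfl, rfl⟩ := h
    have hne : σ.symm i ≠ σ.symm j := fun h' => hij (σ.symm.injective h')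
    simp [hne, mul_assoc]
  · rw [if_neg h, if_neg h, add_zero]
    by_cases hkl : k = l
    · subst hkl; simp
    · simp [hkl]

/-- A non-trivial additive character is moved by every dilation `x ↦ c x`, `c ≠ 1`: if
`ψ(c x) = ψ(x)` for all `x` then `ψ = 1` (`ψ((c - 1) x) = 1` and `x ↦ (c - 1) x` is onto).
[folklore] -/
theorem _root_.AddChar.eq_one_of_forall_apply_mul_eq {M : Type*} [CommGroup M] {ψ : AddChar F M}
    {c : F} (hc : c ≠ 1) (h : ∀ x, ψ (c * x) = ψ x) : ψ = 1 := by
  ext y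
  have hc1 : c - 1 ≠ 0 := sub_ne_zero.2 hc
  have h1 := h (y / (c - 1))
  rw [show c * (y / (c - 1)) = (c - 1) * (y / (c - 1)) + y / (c - 1) by ring,
    AddChar.map_add_eq_mul, mul_eq_right, mul_div_cancel₀ _ hc1] at h1
  rw [h1, AddChar.one_apply]

/-- **Relevance forces descents by one.** Let `m = diag(d) P_σ` be `ψ`-relevant for a non-trivial
`ψ`: `ψ_U(m u m⁻¹) = ψ_U(u)` whenever `u, m u m⁻¹ ∈ U_n`. Then for each `i` (with `i + 1 < n`),
writing `a = σ⁻¹ i`, `b = σ⁻¹ (i+1)`: either `b < a`, or `b = a + 1` and `d_a = d_b`. (Test on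
`u = 1 + x E_{i,i+1}`: if `a < b` then `ψ(x) = ψ_U(1 + d_a x d_b⁻¹ E_{ab}) = ψ(d_a d_b⁻¹ x [b = a+1])`
for all `x`.) (Gelfand–Kazhdan 1975, §4; Bump 1997, p. 456 for `n = 2`: on the small cell only
`a = d` contributes.) [cite: GelfandKazhdan1975, §4] -/
theorem descent_or_of_relevant {ψ : AddChar F Circle} (hψ : ψ ≠ 1) (d : Fin n → Fˣ)
    (σ : Equiv.Perm (Fin n))
    (hrel : ∀ u : GL (Fin n) F, ∀ hu : u ∈ upperUnitriangular (Fin n) F,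
      ∀ hu' : (diagonalGL (Fin n) F d * permGL σ) * u * (diagonalGL (Fin n) F d * permGL σ)⁻¹ ∈
        upperUnitriangular (Fin n) F,
      whittakerCharFun ψ ⟨_, hu'⟩ = whittakerCharFun ψ ⟨u, hu⟩)
    {i j : Fin n} (hij : (j : ℕ) = i + 1) :
    σ.symm j < σ.symm i ∨
      ((((σ.symm i : Fin n) : ℕ) + 1 = σ.symm j) ∧ d (σ.symm i) = d (σ.symm j)) := by
  have hij' : i < j := Fin.lt_def.2 (by omega)
  set a := σ.symm i with ha
  set b := σ.symm j with hb
  have hab : a ≠ b := fun h => hij'.ne (σ.symm.injective h)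
  rcases lt_or_gt_of_ne hab with hlt | hgt
  · right
    -- `ψ(x) = ψ_U(1 + d_a x d_b⁻¹ E_{ab})` for all `x`
    have key : ∀ x : F, ((ψ x : Circle) : ℂ) =
        if (a : ℕ) + 1 = b then ((ψ ((d a : F) * x * ((d b)⁻¹ : Fˣ)) : Circle) : ℂ) else 1 := by
      intro x
      have hmem := transvectionGL_mem_upperUnitriangular hij' x
      have hconj := conj_transvectionGL d σ hij'.ne x
      have hmem' : (diagonalGL (Fin n) F d * permGL σ) * transvectionGL i j hij'.ne x *
          (diagonalGL (Fin n) F d * permGL σ)⁻¹ ∈ upperUnitriangular (Fin n) F := by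
        rw [hconj]; exact transvectionGL_mem_upperUnitriangular hlt _
      have h1 := hrel _ hmem hmem'
      rw [whittakerCharFun_transvectionGL_of_lt ψ hij', if_pos hij.symm] at h1
      rw [← h1]
      have : (⟨_, hmem'⟩ : ↥(upperUnitriangular (Fin n) F)) =
          ⟨_, transvectionGL_mem_upperUnitriangular hlt ((d a : F) * x * ((d b)⁻¹ : Fˣ))⟩ :=
        Subtype.ext hconj
      rw [this, whittakerCharFun_transvectionGL_of_lt ψ hlt]
    by_cases hab1 : (a : ℕ) + 1 = b
    · refine ⟨hab1, ?_⟩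
      simp only [if_pos hab1] at key
      by_contra hne
      apply hψ
      refine AddChar.eq_one_of_forall_apply_mul_eq (c := (d a : F) * ((d b)⁻¹ : Fˣ)) ?_ fun x => ?_
      · intro h
        apply hne
        rw [← Units.val_mul, Units.val_eq_one, mul_inv_eq_one] at h
        exact h
      · have := key x
        rw [mul_right_comm] at this
        exact (Circle.coe_injective this).symm
    · exfalso
      simp only [if_neg hab1] at key
      apply hψ
      ext x
      have := key x
      rw [AddChar.one_apply]
      simpa using this
  · exact Or.inl hgt

/-- Entries of a monomial matrix `diag(d) P_σ`: `(d P_σ)_{kl} = d_k [σ k = l]`. [folklore] -/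
lemma diagonalGL_mul_permGL_apply (d : Fin n → Fˣ) (σ : Equiv.Perm (Fin n)) (k l : Fin n) :
    ((diagonalGL (Fin n) F d * permGL σ : GL (Fin n) F) : Matrix (Fin n) (Fin n) F) k l =
      if σ k = l then (d k : F) else 0 := by
  rw [Units.val_mul, coe_diagonalGL, Matrix.diagonal_mul, coe_permGL, permMatrix_apply']
  split_ifs <;> simp

variable [TopologicalSpace F]

/-- **Gelfand–Kazhdan's lemma: a `ψ`-relevant monomial matrix is fixed by the involution
`ι(g) = w⁰ ᵗg w⁰`.** If `ψ ≠ 1` and `ψ_U(m u m⁻¹) = ψ_U(u)` for all `u ∈ U_n` with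
`m u m⁻¹ ∈ U_n`, where `m = diag(d) P_σ`, then `ι(m) = m`. By `descent_or_of_relevant` the
permutation `κ = rev ∘ σ⁻¹` and the colouring `c = d ∘ rev` satisfy the hypothesis of
`perm_involutive_of_descents_by_one`, whence `σ ∘ rev = rev ∘ σ⁻¹` and `d_i = d_{rev (σ i)}`, which
is `ι(m) = m` entrywise (`ι(m)_{ij} = m_{rev j, rev i} = d_{rev j} [σ (rev j) = rev i]`).
(Gelfand–Kazhdan 1975, §4: the relevant double cosets `U m U` are those with
`m = diag(λ₁ I_{n₁}, …, λ_k I_{n_k}) w`, `w` the block anti-diagonal permutation, all fixed by the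
anti-involution; Bernstein–Zelevinsky 1976, §7; Bump 1997, pp. 456–457 for `n = 2`.)
[cite: GelfandKazhdan1975, §4] [cite: Bump1997, Theorem 4.4.2 proof, pp. 456–457] -/
theorem gkInvolution_eq_self_of_relevant {ψ : AddChar F Circle} (hψ : ψ ≠ 1) (d : Fin n → Fˣ)
    (σ : Equiv.Perm (Fin n))
    (hrel : ∀ u : GL (Fin n) F, ∀ hu : u ∈ upperUnitriangular (Fin n) F,
      ∀ hu' : (diagonalGL (Fin n) F d * permGL σ) * u * (diagonalGL (Fin n) F d * permGL σ)⁻¹ ∈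
        upperUnitriangular (Fin n) F,
      whittakerCharFun ψ ⟨_, hu'⟩ = whittakerCharFun ψ ⟨u, hu⟩) :
    gkInvolution (diagonalGL (Fin n) F d * permGL σ) = diagonalGL (Fin n) F d * permGL σ := by
  -- the combinatorial lemma for `κ = rev ∘ σ⁻¹`, `c = d ∘ rev`
  set κ : Equiv.Perm (Fin n) := Fin.revPerm * σ⁻¹ with hκ
  have hκa : ∀ i, κ i = Fin.rev (σ.symm i) := fun i => rfl
  set c : Fin n → Fˣ := fun i => d (Fin.rev i) with hc
  have hyp : ∀ i j : Fin n, (j : ℕ) = i + 1 →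
      κ i < κ j ∨ (((κ j : Fin n) : ℕ) + 1 = κ i ∧ c (κ j) = c (κ i)) := by
    intro i j hij
    rcases descent_or_of_relevant hψ d σ hrel hij with hlt | ⟨heq, hd⟩
    · exact Or.inl (by rw [hκa, hκa]; exact Fin.rev_lt_rev.2 hlt)
    · refine Or.inr ⟨?_, ?_⟩
      · rw [hκa, hκa, Fin.val_rev, Fin.val_rev]
        have := (σ.symm i).isLt
        have := (σ.symm j).isLt
        omega
      · simp only [hc, hκa, Fin.rev_rev]
        exact hd.symm
  have hconcl := perm_involutive_of_descents_by_one κ c hyp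
  -- `σ (rev y) = rev (σ⁻¹ y)` and `d (rev (σ i)) = d i`
  have hI1 : ∀ y, σ (Fin.rev y) = Fin.rev (σ.symm y) := by
    intro y
    have h1 := (hconcl (σ (Fin.rev y))).1
    simp only [hκa, Equiv.symm_apply_apply, Fin.rev_rev] at h1
    -- h1 : rev (σ.symm y) ... = σ (rev y)
    exact h1.symm
  have hI2 : ∀ i, d (Fin.rev (σ i)) = d i := by
    intro i
    have h2 := (hconcl (σ i)).2
    simp only [hc, hκa, Equiv.symm_apply_apply, Fin.rev_rev] at h2
    exact h2.symm
  -- entrywise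
  apply Units.ext
  ext i j
  rw [coe_gkInvolution_apply, diagonalGL_mul_permGL_apply, diagonalGL_mul_permGL_apply]
  have hiff : σ (Fin.rev j) = Fin.rev i ↔ σ i = j := by
    rw [hI1]
    constructor
    · intro h; rw [← Equiv.apply_symm_apply σ j, Fin.rev_injective h]
    · intro h; rw [← h, Equiv.symm_apply_apply]
  by_cases h : σ i = j
  · rw [if_pos (hiff.2 h), if_pos h, ← h, hI2]
  · rw [if_neg (fun h' => h (hiff.1 h')), if_neg h]

/-- **The dichotomy used cell by cell**: a monomial matrix `m = diag(d) P_σ` is either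
`ψ`-irrelevant — some `u ∈ U_n` with `m u m⁻¹ ∈ U_n` has `ψ_U(m u m⁻¹) ≠ ψ_U(u)` — or fixed by
`ι`. [cite: GelfandKazhdan1975, §4] -/
theorem exists_whittakerCharFun_conj_ne_or_gkInvolution_eq {ψ : AddChar F Circle} (hψ : ψ ≠ 1)
    (d : Fin n → Fˣ) (σ : Equiv.Perm (Fin n)) :
    (∃ u : GL (Fin n) F, ∃ hu : u ∈ upperUnitriangular (Fin n) F,
      ∃ hu' : (diagonalGL (Fin n) F d * permGL σ) * u * (diagonalGL (Fin n) F d * permGL σ)⁻¹ ∈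
        upperUnitriangular (Fin n) F,
      whittakerCharFun ψ ⟨_, hu'⟩ ≠ whittakerCharFun ψ ⟨u, hu⟩) ∨
    gkInvolution (diagonalGL (Fin n) F d * permGL σ) = diagonalGL (Fin n) F d * permGL σ := by
  refine or_iff_not_imp_left.2 fun h => gkInvolution_eq_self_of_relevant hψ d σ fun u hu hu' => ?_
  by_contra hne
  exact h ⟨u, hu, hu', hne⟩

end Matrices

end Literature.NumberTheory.Automorphic
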